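import Literature.AnabelianGeometry.EtaleTheta.Discharge.Sec2ClassTwoNormalForms
import Literature.AnabelianGeometry.EtaleTheta.ThetaCyclotomes
import Literature.AnabelianGeometry.EtaleTheta.EtaleThetaClass
import Literature.AnabelianGeometry.EtaleTheta.SettingCompletion
import HarnessLib

/-!
# [EtTh] §1 pp. 12–13: "(Δ^tp_Y)^Θ is abelian" — PROVED from the root axioms of the theta setting
# (proof-only; discharges the binder `hYab` of the §2 rigidity chain for the §1 model)

Mochizuki, *The étale theta function and its Frobenioid-theoretic manifestations*, Publ. RIMS **45**
(2009) [EtTh], §1, PRIMS PDF pp. 12–13 (printed 238–239): "we have a natural exact sequence of abelian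
profinite groups `1 → Δ_Θ → (Δ^tp_Y)^Θ → (Δ^tp_Y)^ell → 1`" [cite: MochizukiEtTh2009, §1 p.12]. Layer L2
of the abc-iut cell, seat abc-iut-L2-t8 (gen 2), PROOF-ONLY companion of `Setting.lean` (seat
abc-iut-L2-t1): no definition, no statement of another seat is edited or restated.

WHAT IS PROVED. For `D : ThetaSetting p` satisfying the vacuity guard `D.IsEtThOrigin` ("`Δ_X` is a
profinite free group on 2 generators", p. 12):
`ThetaSetting.dtpYTheta_comm : ∀ x ∈ D.DtpYTheta, ∀ y ∈ D.DtpYTheta, x * y = y * x` — the image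
`(Δ^tp_Y)^Θ` of `Δ^tp_Y = Π^tp_Y ∩ Δ^tp_X` in the theta quotient `(Π^tp_X)^Θ` is COMMUTATIVE. This is
the hypothesis `hYab` of `Discharge/Sec2ThetaGroupCommutators.lean` / `Sec2ThetaGroupHcomm.lean` (seat
abc-iut-L5-t14, item N8 = the `⊆` half of `hcomm`), there carried as a candidate root axiom; it is a
CONSEQUENCE of the root axioms of `Setting.lean` v3 (`IsProfiniteCompletion` of `Π^tp_X → Π_X`,
openness of `Ker(Π^tp_X ↠ Z)`, `Δ^tp_X ↠ Z`, the printed kernel of `Π^tp_X ↠ (Π^tp_X)^Θ`) together with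
the freeness guard. (The companion hypothesis `hYcl` — "(Δ^tp_Y)^Θ is profinite" — is NOT derivable:
witness of abc-iut-L5-t14, INBOX 2026-08-25T21:44:59Z/22:48:44Z; it is untouched here.)

PROOF (classical profinite group theory). Write `ι : Π^tp_X → Π_X`, `Δ_X = D.DeltaHat`,
`K₂ = [Δ_X,Δ_X]⁻`, `K₃ = [[Δ_X,Δ_X],Δ_X]⁻`; the claim is `[ι y, ι y'] ∈ K₃` for `y, y' ∈ Δ^tp_Y`.
(1) SEPARATION: `K₃` is closed, so it suffices to show `[ι y, ι y'] ∈ K₃ · U` for every open normal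
subgroup `U ≤ Π_X` (`ProfiniteGrp.exist_openNormalSubgroup_sub_open_nhds_of_one`). (2) THE CHARACTER:
for `N ≥ 1` the open normal finite-index subgroup `Ker(Π^tp_X ↠ Z ↠ ℤ/N)` is the pull-back of an open
normal `V ≤ Π_X` (`comap_surjective`), and `Π^tp_X/Ker → Π_X/V` is bijective (density), whence a
character `Λ : Π_X → ℤ/N` with open kernel and `Λ ∘ ι = toZ mod N`. (3) GENERATION: by the UNIQUENESS
clause of `IsFreeProfiniteOnTwo` (applied to the finite discrete quotient `Δ_X/(M ∩ Δ_X)`), the free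
pair `a, b` generates `Δ_X` modulo any open normal `M`; abelianising, every `x ∈ Δ_X` is
`a^i b^j c m` with `c ∈ [Δ_X,Δ_X]`, `m ∈ M`. (4) With `M' := K₃ ⊔ U`, `N := #(Π_X/M')`,
`M := M' ∩ Ker Λ`: `Λ(ι y) = 0` gives `iσ + jτ = 0` (`σ = Λ a`, `τ = Λ b`), and `toZ z₁ = 1` for some
`z₁ ∈ Δ^tp_X` makes `(σ, τ)` unimodular, so `N ∣ ij' − ji'` (a `2 × 2` determinant). (5) Witt–Hall
modulo `M'` (`ClassTwo.mk_commutator_*` with `K₃ := M' ⊇ [Δ_X, K₂]`): `[ι y, ι y'] ≡ [a,b]^{ij'−ji'} ≡ 1`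
since `[a,b]^N ∈ M'`. HONEST FRAMING: [EtTh] is refereed; the theta setting is data quoting print,
not asserted to exist; OUR kernel check of a printed sentence from the typed root axioms; nothing here
takes a side on any disputed claim.
-/

noncomputable section

namespace Literature.AnabelianGeometry.EtaleTheta

open Literature.AnabelianGeometry.SemiGraphs
open _root_.Topology
open scoped commutatorElement
open ClassTwo

/-! ### Generic profinite group theory (the class-two algebra is in `Sec2ClassTwoNormalForms.lean`) -/

namespace DtpYAbelian

section Profinite

variable {Γ : Type*} [Group Γ] [TopologicalSpace Γ] [IsTopologicalGroup Γ] [CompactSpace Γ]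
  [TotallyDisconnectedSpace Γ]

/-- **Separation by open normal subgroups**: in a profinite group, a CLOSED subgroup `C` contains
every element that lies in `C · U` for all open normal subgroups `U` (the open normal subgroups form a
base of neighbourhoods of `1`). [cite: SerreGaloisCohomology1997, I §1.1] -/
theorem mem_of_forall_mem_sup (C : Subgroup Γ) (hC : IsClosed (C : Set Γ)) {c : Γ}
    (h : ∀ U : OpenNormalSubgroup Γ, c ∈ C ⊔ U.toSubgroup) : c ∈ C := by
  by_contra hc
  have hO : IsOpen ((fun x : Γ => c * x⁻¹) ⁻¹' (C : Set Γ)ᶜ) :=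
    hC.isOpen_compl.preimage (by fun_prop)
  have h1 : (1 : Γ) ∈ (fun x : Γ => c * x⁻¹) ⁻¹' (C : Set Γ)ᶜ := by
    simpa only [Set.mem_preimage, inv_one, mul_one, Set.mem_compl_iff, SetLike.mem_coe] using hc
  obtain ⟨U, hU⟩ := ProfiniteGrp.exist_openNormalSubgroup_sub_open_nhds_of_one hO h1
  obtain ⟨k, hk, u, hu, hku⟩ := Subgroup.mem_sup_of_normal_right.mp (h U)
  have hu' : u ∈ (fun x : Γ => c * x⁻¹) ⁻¹' (C : Set Γ)ᶜ := hU hu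
  apply hu'
  change c * u⁻¹ ∈ (C : Set Γ)
  rw [← hku, mul_inv_cancel_right]
  exact hk

end Profinite

end DtpYAbelian

/-! ### The theta setting -/

namespace ThetaSetting

open DtpYAbelian

variable {p : ℕ} [Fact p.Prime] (D : ThetaSetting p)

/-- `Π^tp_X ↠ Z ↠ ℤ/Nℤ` is surjective. [cite: MochizukiEtTh2009, §1 p.12] -/
theorem toZMod_surjective (N : ℕ) : Function.Surjective (D.toZMod N) := by
  intro z
  obtain ⟨m, hm⟩ := ZMod.intCast_surjective (Multiplicative.toAdd z)
  obtain ⟨g, hg⟩ := D.toZ_surjective (Multiplicative.ofAdd m)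
  refine ⟨g, ?_⟩
  change Multiplicative.ofAdd (((Multiplicative.toAdd (D.toZ g) : ℤ) : ZMod N)) = z
  rw [hg, toAdd_ofAdd, hm, ofAdd_toAdd]

/-- **The mod-`N` character of `Π_X`** (p. 12, "`Π^tp_X ↠ Z`" and "`Π_X := (Π^tp_X)^∧`"): for `N ≥ 1` the
surjection `Π^tp_X ↠ Z ↠ ℤ/Nℤ` extends along `ι : Π^tp_X → Π_X` to a homomorphism `Λ : Π_X → ℤ/Nℤ` with
OPEN kernel — `Ker(Π^tp_X ↠ ℤ/Nℤ)` is open, normal, of finite index, hence the pull-back of an open normal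
subgroup `V ≤ Π_X` (`IsProfiniteCompletion.comap_surjective`), and `Π^tp_X/Ker → Π_X/V` is a bijection
(density of `ι`). [cite: MochizukiEtTh2009, §1 p.12] -/
theorem exists_character (N : ℕ) [NeZero N] :
    ∃ Λ : D.PiHat →* Multiplicative (ZMod N), IsOpen ((Λ.ker : Subgroup D.PiHat) : Set D.PiHat) ∧
      ∀ g : D.PiTemp, Λ (D.toHat g) = D.toZMod N g := by
  have hopen : IsOpen (((D.toZMod N).ker : Subgroup D.PiTemp) : Set D.PiTemp) := by
    refine Subgroup.isOpen_mono (fun y hy => ?_) D.isOpen_ker_toZ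
    rw [MonoidHom.mem_ker] at hy
    rw [MonoidHom.mem_ker, toZMod_eq_one_iff, hy, toAdd_one]
    exact dvd_zero _
  let U₀ : OpenNormalSubgroup D.PiTemp :=
    { toSubgroup := (D.toZMod N).ker, isOpen' := hopen, isNormal' := inferInstance }
  have hfi : U₀.toSubgroup.FiniteIndex := by
    refine ⟨?_⟩
    change (D.toZMod N).ker.index ≠ 0
    rw [Subgroup.index_ker]
    exact Nat.card_pos.ne'
  obtain ⟨V, hV⟩ := D.isProfiniteCompletion_toHat.comap_surjective U₀ hfi
  change (D.toZMod N).ker = V.toSubgroup.comap D.toHat.toMonoidHom at hV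
  let e : D.PiTemp ⧸ (D.toZMod N).ker →* D.PiHat ⧸ V.toSubgroup :=
    QuotientGroup.map (D.toZMod N).ker V.toSubgroup D.toHat.toMonoidHom (le_of_eq hV)
  have he_inj : Function.Injective e := by
    rw [← MonoidHom.ker_eq_bot_iff, eq_bot_iff]
    intro q hq
    obtain ⟨g, rfl⟩ := QuotientGroup.mk_surjective q
    rw [MonoidHom.mem_ker, QuotientGroup.map_mk, QuotientGroup.eq_one_iff] at hq
    rw [Subgroup.mem_bot, QuotientGroup.eq_one_iff, hV]
    exact hq
  have he_surj : Function.Surjective e := by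
    intro q
    obtain ⟨h, rfl⟩ := QuotientGroup.mk_surjective q
    have hopen' : IsOpen ((fun x : D.PiHat => h⁻¹ * x) ⁻¹' (V : Set D.PiHat)) :=
      V.toOpenSubgroup.isOpen.preimage (by fun_prop)
    have hne : ((fun x : D.PiHat => h⁻¹ * x) ⁻¹' (V : Set D.PiHat)).Nonempty :=
      ⟨h, by simp only [Set.mem_preimage, inv_mul_cancel, SetLike.mem_coe, one_mem]⟩
    obtain ⟨g, hg⟩ := D.isProfiniteCompletion_toHat.denseRange.exists_mem_open hopen' hne
    refine ⟨QuotientGroup.mk g, ?_⟩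
    change QuotientGroup.mk (D.toHat.toMonoidHom g) = QuotientGroup.mk h
    rw [QuotientGroup.eq]
    have hg' : h⁻¹ * D.toHat g ∈ V := hg
    have := V.toSubgroup.inv_mem hg'
    rw [mul_inv_rev, inv_inv] at this
    exact this
  let eE : D.PiTemp ⧸ (D.toZMod N).ker ≃* D.PiHat ⧸ V.toSubgroup :=
    MulEquiv.ofBijective e ⟨he_inj, he_surj⟩
  let Λ : D.PiHat →* Multiplicative (ZMod N) :=
    ((QuotientGroup.kerLift (D.toZMod N)).comp eE.symm.toMonoidHom).comp
      (QuotientGroup.mk' V.toSubgroup)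
  refine ⟨Λ, ?_, fun g => ?_⟩
  · refine Subgroup.isOpen_mono (fun v hv => ?_) V.toOpenSubgroup.isOpen
    rw [MonoidHom.mem_ker]
    change QuotientGroup.kerLift (D.toZMod N) (eE.symm (QuotientGroup.mk' V.toSubgroup v)) = 1
    rw [QuotientGroup.mk'_apply, (QuotientGroup.eq_one_iff v).mpr hv, map_one, map_one]
  · change QuotientGroup.kerLift (D.toZMod N) (eE.symm (QuotientGroup.mk' V.toSubgroup (D.toHat g))) =
      D.toZMod N g
    have heg : eE (QuotientGroup.mk g) = QuotientGroup.mk' V.toSubgroup (D.toHat g) := by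
      change e (QuotientGroup.mk g) = _
      rw [QuotientGroup.map_mk, QuotientGroup.mk'_apply]
      rfl
    rw [← heg, MulEquiv.symm_apply_apply, QuotientGroup.kerLift_mk]

variable {D} in
/-- **The free pair generates `Δ_X` modulo every open normal subgroup** ("`Δ_X` is a profinite free
group on 2 generators", p. 12): by the UNIQUENESS clause of `IsFreeProfiniteOnTwo` (against the finite
discrete quotient `Δ_X/(M ∩ Δ_X)` and the subgroup generated by the images of `a, b` in it), every
`x ∈ Δ_X` is `s · m` with `s` in the subgroup generated by `a, b` and `m ∈ M`.
[cite: MochizukiEtTh2009, §1 p.12] -/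
theorem IsEtThOrigin.exists_generators (hO : D.IsEtThOrigin) :
    ∃ a b : D.DeltaHat, ∀ M : Subgroup D.PiHat, M.Normal → IsOpen (M : Set D.PiHat) →
      ∀ x ∈ D.DeltaHat, ∃ s ∈ Subgroup.closure ({(a : D.PiHat), (b : D.PiHat)} : Set D.PiHat),
        ∃ m ∈ M, x = s * m := by
  obtain ⟨hcpt, _, _, a, b, huniv⟩ := hO.deltaHat_free
  refine ⟨a, b, fun M hMn hMo x hx => ?_⟩
  haveI : CompactSpace D.DeltaHat := hcpt
  haveI : M.Normal := hMn
  let MΔ : Subgroup D.DeltaHat := M.subgroupOf D.DeltaHat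
  have hMΔo : IsOpen (MΔ : Set D.DeltaHat) := hMo.preimage continuous_subtype_val
  haveI : DiscreteTopology (D.DeltaHat ⧸ MΔ) := QuotientGroup.discreteTopology hMΔo
  haveI : Finite (D.DeltaHat ⧸ MΔ) := Subgroup.quotient_finite_of_isOpen MΔ hMΔo
  let π : D.DeltaHat →ₜ* D.DeltaHat ⧸ MΔ :=
    { toMonoidHom := QuotientGroup.mk' MΔ, continuous_toFun := QuotientGroup.continuous_mk }
  let H : Subgroup (D.DeltaHat ⧸ MΔ) := Subgroup.closure ({π a, π b} : Set (D.DeltaHat ⧸ MΔ))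
  have haH : π a ∈ H := Subgroup.subset_closure (Set.mem_insert _ _)
  have hbH : π b ∈ H := Subgroup.subset_closure (Set.mem_insert_of_mem _ (Set.mem_singleton _))
  obtain ⟨f, ⟨hfa, hfb⟩, -⟩ := huniv H ⟨π a, haH⟩ ⟨π b, hbH⟩
  obtain ⟨g₀, -, hg₀⟩ := huniv (D.DeltaHat ⧸ MΔ) (π a) (π b)
  let g₁ : D.DeltaHat →ₜ* D.DeltaHat ⧸ MΔ :=
    { toMonoidHom := H.subtype.comp f.toMonoidHom
      continuous_toFun := continuous_subtype_val.comp f.continuous_toFun }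
  have h1 : g₁ = g₀ := by
    refine hg₀ g₁ ⟨?_, ?_⟩
    · change (f a : D.DeltaHat ⧸ MΔ) = π a
      rw [hfa]
    · change (f b : D.DeltaHat ⧸ MΔ) = π b
      rw [hfb]
  have h2 : π = g₀ := hg₀ π ⟨rfl, rfl⟩
  have hπH : ∀ y : D.DeltaHat, π y ∈ H := by
    intro y
    have hy : π y = g₁ y := by rw [h1, ← h2]
    rw [hy]
    exact (f y).2
  have hHeq : H = (Subgroup.closure ({a, b} : Set D.DeltaHat)).map (QuotientGroup.mk' MΔ) := by
    rw [MonoidHom.map_closure, Set.image_pair]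
    rfl
  have hxH := hπH ⟨x, hx⟩
  rw [hHeq] at hxH
  obtain ⟨s, hs, hsx⟩ := hxH
  have hm : s⁻¹ * ⟨x, hx⟩ ∈ MΔ := by
    rw [← QuotientGroup.eq]
    exact hsx
  refine ⟨(s : D.PiHat), ?_, ((s⁻¹ * ⟨x, hx⟩ : D.DeltaHat) : D.PiHat),
    Subgroup.mem_subgroupOf.mp hm, ?_⟩
  · have hs' := Subgroup.mem_map_of_mem D.DeltaHat.subtype hs
    rw [MonoidHom.map_closure, Set.image_pair] at hs'
    exact hs'
  · simp only [Subgroup.coe_mul, Subgroup.coe_inv, mul_inv_cancel_left]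

/-- **`[ι y, ι y'] ∈ [[Δ_X,Δ_X],Δ_X]⁻` for `y, y' ∈ Δ^tp_Y`** — the heart of "(Δ^tp_Y)^Θ is abelian"
(pp. 12–13), from the root axioms and the freeness guard; see the module docstring for the proof.
[cite: MochizukiEtTh2009, §1 p.12] -/
theorem commutator_toHat_mem_tripleCommutatorClosure (hO : D.IsEtThOrigin) {y y' : D.PiTemp}
    (hy : y ∈ D.DtpY) (hy' : y' ∈ D.DtpY) :
    ⁅D.toHat.toMonoidHom y, D.toHat.toMonoidHom y'⁆ ∈
      (⁅⁅D.DeltaHat, D.DeltaHat⁆, D.DeltaHat⁆).topologicalClosure := by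
  haveI : CompactSpace D.PiHat := D.isProfiniteCompletion_toHat.compactSpace
  haveI : TotallyDisconnectedSpace D.PiHat := D.isProfiniteCompletion_toHat.totallyDisconnectedSpace
  haveI hΔn : D.DeltaHat.Normal := SettingCompletion.deltaHat_normal D.toTemperedCurve
  haveI hK₃n : (⁅⁅D.DeltaHat, D.DeltaHat⁆, D.DeltaHat⁆).topologicalClosure.Normal :=
    Subgroup.is_normal_topologicalClosure _
  have hK₃closed : IsClosed
      (((⁅⁅D.DeltaHat, D.DeltaHat⁆, D.DeltaHat⁆).topologicalClosure : Subgroup D.PiHat) :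
        Set D.PiHat) :=
    Subgroup.isClosed_topologicalClosure _
  -- class-two data `A = Δ_X ⊇ K₂ = [Δ_X,Δ_X]⁻`
  have hAA : ⁅D.DeltaHat, D.DeltaHat⁆ ≤ (⁅D.DeltaHat, D.DeltaHat⁆).topologicalClosure :=
    Subgroup.le_topologicalClosure _
  have hK₂A : (⁅D.DeltaHat, D.DeltaHat⁆).topologicalClosure ≤ D.DeltaHat :=
    D.commutatorClosure_le_deltaHat
  have hAK : ⁅D.DeltaHat, (⁅D.DeltaHat, D.DeltaHat⁆).topologicalClosure⁆ ≤
      (⁅⁅D.DeltaHat, D.DeltaHat⁆, D.DeltaHat⁆).topologicalClosure := by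
    refine (commutator_topologicalClosure_right_le _ _).trans (le_of_eq ?_)
    rw [Subgroup.commutator_comm D.DeltaHat ⁅D.DeltaHat, D.DeltaHat⁆]
  -- the three elements of `Δ_X`: `ι y`, `ι y'`, `ι z₁` with `toZ z₁ = 1`
  have hyΔ : D.toHat.toMonoidHom y ∈ D.DeltaHat :=
    Subgroup.le_topologicalClosure _ ⟨y, (Subgroup.mem_inf.mp hy).2, rfl⟩
  have hy'Δ : D.toHat.toMonoidHom y' ∈ D.DeltaHat :=
    Subgroup.le_topologicalClosure _ ⟨y', (Subgroup.mem_inf.mp hy').2, rfl⟩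
  obtain ⟨⟨z₁, hz₁Δ⟩, hz₁Z'⟩ := D.toZ_delta_surjective (Multiplicative.ofAdd 1)
  have hz₁Z : D.toZ z₁ = Multiplicative.ofAdd 1 := hz₁Z'
  have hz₁Δ' : D.toHat.toMonoidHom z₁ ∈ D.DeltaHat :=
    Subgroup.le_topologicalClosure _ ⟨z₁, hz₁Δ, rfl⟩
  obtain ⟨a, b, hgen⟩ := hO.exists_generators
  -- (1) separation
  refine mem_of_forall_mem_sup _ hK₃closed fun U => ?_
  let M' : Subgroup D.PiHat :=
    (⁅⁅D.DeltaHat, D.DeltaHat⁆, D.DeltaHat⁆).topologicalClosure ⊔ U.toSubgroup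
  haveI hM'n : M'.Normal := inferInstance
  have hM'o : IsOpen (M' : Set D.PiHat) :=
    Subgroup.isOpen_mono (le_sup_right : U.toSubgroup ≤ M') U.toOpenSubgroup.isOpen
  haveI : Finite (D.PiHat ⧸ M') := Subgroup.quotient_finite_of_isOpen M' hM'o
  -- (2) the character mod `N = #(Π_X/M')`
  haveI : NeZero (Nat.card (D.PiHat ⧸ M')) := ⟨Nat.card_pos.ne'⟩
  obtain ⟨Λ, hΛo, hΛ⟩ := D.exists_character (Nat.card (D.PiHat ⧸ M'))
  let M : Subgroup D.PiHat := M' ⊓ Λ.ker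
  haveI hMn : M.Normal := inferInstance
  have hMo : IsOpen (M : Set D.PiHat) := hM'o.inter hΛo
  have hMM' : M ≤ M' := inf_le_left
  have hMΛ : M ≤ Λ.ker := inf_le_right
  -- class-two data modulo `M'`
  have hAK' : ⁅D.DeltaHat, (⁅D.DeltaHat, D.DeltaHat⁆).topologicalClosure⁆ ≤ M' :=
    hAK.trans le_sup_left
  -- (3) normal forms
  obtain ⟨s, hs, m, hm, hys⟩ := hgen M hMn hMo _ hyΔ
  obtain ⟨i, j, c, hc, rfl⟩ := exists_normalForm_of_mem_closure_pair D.DeltaHat a.2 b.2 hs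
  obtain ⟨s', hs', m', hm', hys'⟩ := hgen M hMn hMo _ hy'Δ
  obtain ⟨i', j', c', hc', rfl⟩ := exists_normalForm_of_mem_closure_pair D.DeltaHat a.2 b.2 hs'
  obtain ⟨s₁, hs₁, m₁, hm₁, hzs₁⟩ := hgen M hMn hMo _ hz₁Δ'
  obtain ⟨i₁, j₁, c₁, hc₁, rfl⟩ := exists_normalForm_of_mem_closure_pair D.DeltaHat a.2 b.2 hs₁
  -- (4) the character: `Λ` kills `[Δ_X, Δ_X]` and `M`
  have hΛcomm : ∀ d ∈ ⁅D.DeltaHat, D.DeltaHat⁆, Λ d = 1 := fun d hd =>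
    (Abelianization.commutator_subset_ker Λ) (Subgroup.commutator_mono le_top le_top hd)
  have hΛval : ∀ (i j : ℤ) {c m : D.PiHat}, c ∈ ⁅D.DeltaHat, D.DeltaHat⁆ → m ∈ M →
      Multiplicative.toAdd (Λ ((a : D.PiHat) ^ i * (b : D.PiHat) ^ j * c * m)) =
        (i : ZMod _) * Multiplicative.toAdd (Λ a) + (j : ZMod _) * Multiplicative.toAdd (Λ b) := by
    intro i j c m hc hm
    have hΛm : Λ m = 1 := (MonoidHom.mem_ker).mp (hMΛ hm)
    have hmul : Λ ((a : D.PiHat) ^ i * (b : D.PiHat) ^ j * c * m) = Λ a ^ i * Λ b ^ j := by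
      rw [map_mul, map_mul, map_mul, map_zpow, map_zpow, hΛcomm c hc, mul_one, hΛm, mul_one]
    rw [hmul, toAdd_mul, toAdd_zpow, toAdd_zpow, zsmul_eq_mul, zsmul_eq_mul]
  have hΛy : ∀ {y : D.PiTemp}, y ∈ D.DtpY → Λ (D.toHat.toMonoidHom y) = 1 := by
    intro y hy
    have hyZ : D.toZ y = 1 := (Subgroup.mem_inf.mp hy).1
    change Λ (D.toHat y) = 1
    rw [hΛ, toZMod_eq_one_iff, hyZ, toAdd_one]
    exact dvd_zero _
  have h1 : (i : ZMod (Nat.card (D.PiHat ⧸ M'))) * Multiplicative.toAdd (Λ a) +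
      (j : ZMod _) * Multiplicative.toAdd (Λ b) = 0 := by
    rw [← hΛval i j hc hm, ← hys, hΛy hy, toAdd_one]
  have h2 : (i' : ZMod (Nat.card (D.PiHat ⧸ M'))) * Multiplicative.toAdd (Λ a) +
      (j' : ZMod _) * Multiplicative.toAdd (Λ b) = 0 := by
    rw [← hΛval i' j' hc' hm', ← hys', hΛy hy', toAdd_one]
  have h3 : (i₁ : ZMod (Nat.card (D.PiHat ⧸ M'))) * Multiplicative.toAdd (Λ a) +
      (j₁ : ZMod _) * Multiplicative.toAdd (Λ b) = 1 := by
    rw [← hΛval i₁ j₁ hc₁ hm₁, ← hzs₁]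
    change Multiplicative.toAdd (Λ (D.toHat z₁)) = 1
    rw [hΛ]
    change (((Multiplicative.toAdd (D.toZ z₁) : ℤ) : ZMod (Nat.card (D.PiHat ⧸ M')))) = 1
    rw [hz₁Z, toAdd_ofAdd, Int.cast_one]
  have hdet : ((i * j' - j * i' : ℤ) : ZMod (Nat.card (D.PiHat ⧸ M'))) = 0 := by
    push_cast
    exact det_eq_zero_of_unimodular h1 h2 h3
  obtain ⟨k, hk⟩ := (ZMod.intCast_zmod_eq_zero_iff_dvd _ _).mp hdet
  -- (5) Witt–Hall modulo `M'`
  have hγN : (((⁅(a : D.PiHat), (b : D.PiHat)⁆ : D.PiHat) : D.PiHat ⧸ M')) ^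
      (Nat.card (D.PiHat ⧸ M') : ℤ) = 1 := by
    rw [zpow_natCast]
    exact pow_card_eq_one'
  have hmod : ∀ {x m : D.PiHat}, m ∈ M →
      QuotientGroup.mk' M' (x * m) = QuotientGroup.mk' M' x := by
    intro x m hm
    rw [map_mul, QuotientGroup.mk'_apply M' m, (QuotientGroup.eq_one_iff m).mpr (hMM' hm), mul_one]
  have key : QuotientGroup.mk' M' ⁅D.toHat.toMonoidHom y, D.toHat.toMonoidHom y'⁆ = 1 := by
    rw [hys, hys', map_commutatorElement, hmod hm, hmod hm', ← map_commutatorElement,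
      QuotientGroup.mk'_apply M',
      mk_commutator_normalForm D.DeltaHat _ M' hAA hK₂A hAK' a.2 b.2 (hAA hc) (hAA hc') i j i' j',
      hk, zpow_mul, hγN, one_zpow]
  exact (QuotientGroup.eq_one_iff _).mp key

/-- **"(Δ^tp_Y)^Θ is abelian"** ([EtTh] pp. 12–13: "a natural exact sequence of abelian profinite
groups `1 → Δ_Θ → (Δ^tp_Y)^Θ → (Δ^tp_Y)^ell → 1`") — PROVED from the root axioms of `Setting.lean` and the
freeness guard `IsEtThOrigin`: the image `(Δ^tp_Y)^Θ = D.DtpYTheta` of `Δ^tp_Y` in `(Π^tp_X)^Θ` is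
commutative. This is the hypothesis `hYab` of the §2 rigidity chain for the §1 model
(`Discharge/Sec2ThetaGroupCommutators.lean`, seat abc-iut-L5-t14), now discharged.
[cite: MochizukiEtTh2009, §1 p.12] -/
theorem dtpYTheta_comm (hO : D.IsEtThOrigin) :
    ∀ x ∈ D.DtpYTheta, ∀ y ∈ D.DtpYTheta, x * y = y * x := by
  rintro _ ⟨y, hy, rfl⟩ _ ⟨y', hy', rfl⟩
  rw [← commutatorElement_eq_one_iff_mul_comm, ← map_commutatorElement, ← MonoidHom.mem_ker,
    D.ker_toTheta, Subgroup.mem_comap, map_commutatorElement]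
  exact D.commutator_toHat_mem_tripleCommutatorClosure hO hy hy'

end ThetaSetting

end Literature.AnabelianGeometry.EtaleTheta

end
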